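import Mathlib.RingTheory.Polynomial.Eisenstein.IsIntegral
import Mathlib.RingTheory.Polynomial.Cyclotomic.Eval
import Mathlib.RingTheory.Polynomial.Cyclotomic.Roots
import Mathlib.RingTheory.Polynomial.GaussLemma
import Mathlib.RingTheory.Polynomial.RationalRoot
import Mathlib.RingTheory.Polynomial.UniqueFactorization
import Mathlib.RingTheory.MvPolynomial.Basic
import Mathlib.RingTheory.AlgebraicIndependent.Adjoin
import Mathlib.RingTheory.AlgebraicIndependent.TranscendenceBasis
import Mathlib.RingTheory.AlgebraicIndependent.AlgebraicClosure
import Mathlib.RingTheory.WittVector.DiscreteValuationRing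
import Mathlib.FieldTheory.IntermediateField.Adjoin.Algebra
import Mathlib.FieldTheory.Minpoly.Field
import Mathlib.Algebra.Polynomial.Taylor
import Literature.AnabelianGeometry.AbsoluteAnabelian.SubpadicIsGeneralizedSubpadic
import Literature.AnabelianGeometry.AbsoluteAnabelian.SubpadicFiniteExtension
import Literature.AnabelianGeometry.AbsoluteAnabelian.SubpadicGaloisSlim
import Literature.AnabelianGeometry.AbsoluteAnabelian.AbsTopIII.KummerFaithfulCyclotomicProofs
import HarnessLib

/-!
# The `p`-adic cyclotomic character of a GENERALIZED sub-`p`-adic field has open image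
# ([AbsTopI] Ex 4.8 (i): "the prime `p` clearly serves as a prime `l`"), proof-only

Authors: abc-iut-L4-t13 (gen 2).

S. Mochizuki, *Topics in Absolute Anabelian Geometry I: Generalities* [AbsTopI] (bib key
`MochizukiAbsTopI2012`, kurims manuscript pagination, lit key `paper:url-11ac98ba15fc`), Example 4.8
(i) p. 58, for the class `𝒟` of hyperbolic orbicurves over generalized sub-`p`-adic fields ([Tpcs] =
`MochizukiTopics2003`, Def 4.11 p. 44: subfields of finitely generated extensions of `Frac W(𝔽̄_p)`):
"The hypotheses of Theorem 4.7, (i), (ii), are satisfied relative to this `𝒟`. [...] the prime `p`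
clearly serves as a prime “`l`” as in the statement of Theorem 4.7" — i.e. hypothesis (b) of Thm
4.7 p. 56 ("there exists a prime number `l ∈ Σ₁ ∩ Σ₂` such that for `i = 1, 2`, the cyclotomic
character `G_i → ℤ_l^×` [...] has open image"), the hypothesis of Lemma 4.5 p. 54 ("`l ∈ Σ` a prime
such that the cyclotomic character `χ_G^cyclo : G → ℤ_l^×` [...] has open image [i.e., in the
terminology of [Mzk12], “the outer action of `G` on `Δ` is `l`-cyclotomically full”]"), and the
standing hypothesis of [AbsTopII] Cor 3.7 p. 72 ("Suppose further that, for some `l ∈ Σ`, the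
cyclotomic character `G → ℤ_l^×` has open image") in the generality of [AbsTopII] Rmk 3.7.1 (`k`
generalized sub-`p`-adic).  In the cell's typing this is the hypothesis `hcyc` of
`AbsTopI.ConstructionDataClass.ex_4_8_i_of` (`AbsTopI/RelativeGC.lean`, where it was left "an input":
generalized sub-`p`-adic fields are NOT Kummer-faithful in general, [AbsTopIII] Rmk 1.5.4 (iv) =
`AbsTopIII.Rmk_1_5_4_iv_holds`, so [AbsTopIII] Rmk 1.5.1 does not apply as it does for sub-`p`-adic
fields, `AbsTopIII.IsSubpadic.isOpen_range_cyclotomicChar`).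

THIS FILE PROVES IT (`AbsTopIII.IsGeneralizedSubpadicFor.isOpen_range_cyclotomicChar`), by an
elementary route with no class field theory:

1. `Φ_{p^{n+1}}` is irreducible over any domain in which the prime NUMBER `p` is a prime ELEMENT
   (`cyclotomic_prime_pow_irreducible_of_prime`: Mathlib's Eisenstein criterion for
   `Φ_{p^{n+1}}(X+1)` over `ℤ`, `cyclotomic_prime_pow_comp_X_add_one_isEisensteinAt`, transferred
   along `ℤ → A`), in particular over `W(𝔽̄_p)` (Mathlib: a DVR with uniformizer `p`,
   `WittVector.irreducible`) and hence, by Gauss's lemma, over `F := Frac W(𝔽̄_p)`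
   (`cyclotomic_prime_pow_irreducible_fracWitt`).
2. A monic irreducible polynomial over a field `K` stays irreducible over any domain retracting onto
   `K` (`irreducible_map_of_retraction`), e.g. over `K[t_i]` (`t_i ↦ 0`), hence by Gauss's lemma over
   the rational function field `K(t_i) = Frac K[t_i]` (`cyclotomic_irreducible_fractionRing_mvPolynomial`;
   `K[t_i]` is a UFD).
3. (`exists_not_isPrimitiveRoot_of_fg_fracWitt`) If `L/F` is finitely generated with transcendence
   basis `t` (Mathlib `exists_isTranscendenceBasis_subset`, `AlgebraicIndependent.aevalEquivField`, as
   in `GaussOrderDVR.lean`), then `L/F(t)` is finite and a primitive `p^{n+1}`-th root of unity in `L`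
   has minimal polynomial `Φ_{p^{n+1}}` over `F(t)`, so `p^n (p-1) ≤ [L : F(t)]`: `L` contains
   primitive `p^{n+1}`-th roots of unity for NO `n ≥ [L : F(t)]`.
4. (`IsGeneralizedSubpadicFor.isOpen_range_cyclotomicChar`) The image of `χ_p` is compact, hence
   closed, hence finite or open (`PadicInt.finite_or_isOpen_of_isClosed_subgroup_units`,
   `KummerFaithfulCyclotomicProofs.lean`); if finite, the fixed field of `ker χ_p` is a finite extension
   `L₀` of `k` containing `μ_{p^∞}(k̄)` (Krull correspondence, exactly as in `Rmk_1_5_1_holds`), again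
   generalized sub-`p`-adic (`IsGeneralizedSubpadicFor.of_finite`, abc-iut-L4-t13 gen 0), so it embeds
   into a finitely generated `L/F` carrying primitive `p^{n+1}`-th roots of unity for every `n` —
   contradicting 3.

Consequence for the cell's LC1 chain (Belyi cuspidalization, `plan/L4/LC1-CHAIN.md`): together with
`Tpcs.lem_4_14_slim_holds` (abc-iut-L4-d1, slimness) the named fact `ConstructionDataClass.Ex_4_8_i`
reduces to its chain-fullness clause and the relative Grothendieck Conjecture `Tpcs.Thm_4_12` alone
(the FACT boundary proper); see the companion `AbsTopI/RelativeGCInputs.lean`.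

HONEST FRAMING: classical field/Galois theory about OUR real definitions (`IsGeneralizedSubpadicFor`,
`cyclotomicChar`); nothing here bears on [IUTchIII] Cor 3.12 or takes a side; typed ≠ discharged.
Proof-only: no definitions, no named facts.
-/

noncomputable section

open Polynomial

namespace Literature.AnabelianGeometry.AbsoluteAnabelian.AbsTopIII

universe u

/-- Over a domain `A` in which the prime number `p` is a PRIME ELEMENT, the `p^{n+1}`-th cyclotomic
polynomial `Φ_{p^{n+1}}` is irreducible: `Φ_{p^{n+1}}(X + 1)` is Eisenstein at `(p) ⊆ ℤ` (Mathlib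
`cyclotomic_prime_pow_comp_X_add_one_isEisensteinAt`), hence Eisenstein at the prime `(p) ⊆ A` after
base change (coefficients `∈ pℤ ↦ pA`, constant coefficient `Φ_{p^{n+1}}(1) = p ∉ p²A` as `p` is not a
unit), hence irreducible (`Polynomial.IsEisensteinAt.irreducible`), and `X ↦ X + 1` is a ring
automorphism of `A[X]` (`Polynomial.taylorEquiv`).  Eisenstein's criterion, stated for any such `A`
(e.g. `ℤ_p`, `W(𝔽̄_p)`); the step of [AbsTopI] Example 4.8 (i) p. 58 it serves is "the prime `p`
clearly serves as a prime “`l`”" (via `cyclotomic_prime_pow_irreducible_fracWitt`).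
[cite: MochizukiAbsTopI2012, Ex 4.8 (i) p.58] -/
theorem cyclotomic_prime_pow_irreducible_of_prime {A : Type u} [CommRing A] [IsDomain A]
    {p : ℕ} [hp : Fact p.Prime] (hpA : Prime (p : A)) (n : ℕ) :
    Irreducible (cyclotomic (p ^ (n + 1)) A) := by
  -- the Eisenstein polynomial over `ℤ`
  set g : ℤ[X] := (cyclotomic (p ^ (n + 1)) ℤ).comp (X + 1) with hg
  have hgE : g.IsEisensteinAt (Submodule.span ℤ {(p : ℤ)}) :=
    cyclotomic_prime_pow_comp_X_add_one_isEisensteinAt p n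
  have hgmonic : g.Monic := by
    rw [hg, show (X + 1 : ℤ[X]) = X + C 1 by simp]
    refine (cyclotomic.monic _ ℤ).comp (monic_X_add_C 1) fun h => ?_
    rw [natDegree_X_add_C] at h
    exact zero_ne_one h.symm
  -- its image over `A`
  set φ : ℤ →+* A := Int.castRingHom A with hφ
  set gA : A[X] := g.map φ with hgA
  have hgAmonic : gA.Monic := hgmonic.map φ
  have hgA_eq : gA = (cyclotomic (p ^ (n + 1)) A).comp (X + 1) := by
    rw [hgA, hg, Polynomial.map_comp, map_cyclotomic, Polynomial.map_add, map_X, Polynomial.map_one]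
  have hp0 : (p : A) ≠ 0 := hpA.ne_zero
  have hpunit : ¬ IsUnit (p : A) := hpA.not_unit
  set P : Ideal A := Ideal.span {(p : A)} with hP
  have hPprime : P.IsPrime := (Ideal.span_singleton_prime hp0).mpr hpA
  have hPtop : P ≠ ⊤ := hPprime.ne_top
  have hgAE : gA.IsEisensteinAt P := by
    refine hgAmonic.isEisensteinAt_of_mem_of_notMem hPtop ?_ ?_
    · intro i hi
      rw [hgA, hgmonic.natDegree_map] at hi
      have hmem : g.coeff i ∈ Submodule.span ℤ {(p : ℤ)} := hgE.mem hi
      rw [Ideal.submodule_span_eq, Ideal.mem_span_singleton] at hmem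
      obtain ⟨c, hc⟩ := hmem
      rw [hgA, coeff_map, hc, map_mul, map_natCast, hP]
      exact Ideal.mul_mem_right _ _ (Ideal.mem_span_singleton_self _)
    · rw [hgA, coeff_map, coeff_zero_eq_eval_zero, hg, eval_comp, eval_add, eval_X, eval_one,
        zero_add, eval_one_cyclotomic_prime_pow, map_natCast, hP, Ideal.span_singleton_pow,
        Ideal.mem_span_singleton]
      rintro ⟨c, hc⟩
      apply hpunit
      have h1 : (p : A) * (p * c) = (p : A) * 1 := by
        rw [mul_one, ← mul_assoc, ← sq]; exact hc.symm
      exact isUnit_iff_exists_inv.mpr ⟨_, mul_left_cancel₀ hp0 h1⟩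
  -- `gA = taylor 1 Φ` with `Φ = cyclotomic (p^(n+1)) A`
  have hgA_taylor : gA = taylor (1 : A) (cyclotomic (p ^ (n + 1)) A) := by
    rw [hgA_eq, taylor_apply, C_1]
  have hdeg : 0 < gA.natDegree := by
    rw [hgA_taylor, natDegree_taylor, natDegree_cyclotomic]
    exact Nat.totient_pos.mpr (pow_pos hp.out.pos _)
  have hirr : Irreducible gA := hgAE.irreducible hPprime hgAmonic.isPrimitive hdeg
  rw [hgA_taylor, ← coe_taylorEquiv] at hirr
  exact (MulEquiv.irreducible_iff (taylorEquiv (1 : A)).toMulEquiv).mp hirr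

/-- `p` is a prime element of the ring of Witt vectors `W(𝔽̄_p)` — a DVR with uniformizer `p`
(Mathlib `WittVector.irreducible`, `WittVector.isDiscreteValuationRing`); the ring underlying [Tpcs]
Def 4.11 p. 44 "the quotient field of `W(𝔽̄_p)`". [cite: MochizukiTopics2003, Def 4.11 p.44] -/
theorem prime_p_wittVector (p : ℕ) [Fact p.Prime] :
    Prime ((p : ℕ) : WittVector p (AlgebraicClosure (ZMod p))) :=
  (WittVector.irreducible p).prime

/-- The `p^{n+1}`-th cyclotomic polynomial is irreducible over `F = Frac W(𝔽̄_p)`, the base field of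
[Tpcs] Def 4.11 p. 44 (Eisenstein over the DVR `W(𝔽̄_p)`, then Gauss's lemma
`Polynomial.Monic.irreducible_iff_irreducible_map_fraction_map`); equivalently `F(ζ_{p^{n+1}})/F` has
degree `φ(p^{n+1})` — the maximal unramified extension of `ℚ_p`, even completed, is linearly disjoint
from the `p`-cyclotomic tower. [cite: MochizukiTopics2003, Def 4.11 p.44] -/
theorem cyclotomic_prime_pow_irreducible_fracWitt (p : ℕ) [Fact p.Prime] (n : ℕ) :
    Irreducible (cyclotomic (p ^ (n + 1))
      (FractionRing (WittVector p (AlgebraicClosure (ZMod p))))) := by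
  have h := cyclotomic_prime_pow_irreducible_of_prime (prime_p_wittVector p) n
  rw [(cyclotomic.monic _ _).irreducible_iff_irreducible_map_fraction_map
    (K := FractionRing (WittVector p (AlgebraicClosure (ZMod p)))), map_cyclotomic] at h
  exact h

/-- A monic irreducible polynomial over a field `K` stays irreducible over any domain `R` that
RETRACTS onto `K` (`ψ ∘ φ = id`): a factorisation over `R` maps back along `ψ` to one over `K`, where
one factor becomes a unit, i.e. a nonzero constant; as the product is monic the leading coefficients
of both factors are units of `R`, so that factor had degree `0` already over `R` and is a unit there.
[folklore] -/
private theorem irreducible_map_of_retraction {K R : Type*} [Field K] [CommRing R]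
    [IsDomain R] (φ : K →+* R) (ψ : R →+* K) (hψφ : ∀ x, ψ (φ x) = x) {f : K[X]} (hf : f.Monic)
    (hirr : Irreducible f) : Irreducible (f.map φ) := by
  have hfφ : (f.map φ).Monic := hf.map φ
  have hback : (f.map φ).map ψ = f := by
    rw [Polynomial.map_map]
    have : ψ.comp φ = RingHom.id K := RingHom.ext hψφ
    rw [this, Polynomial.map_id]
  have hdeg : 0 < f.natDegree := Irreducible.natDegree_pos hirr
  refine ⟨fun hu => ?_, fun a b hab => ?_⟩
  · rw [hfφ.isUnit_iff] at hu
    have := congrArg natDegree hu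
    rw [hf.natDegree_map, natDegree_one] at this
    omega
  · -- one of the factors is a unit back over `K`
    have hKab : f = a.map ψ * b.map ψ := by rw [← hback, hab, Polynomial.map_mul]
    -- leading coefficients are units
    have hlead : a.leadingCoeff * b.leadingCoeff = 1 := by
      rw [← leadingCoeff_mul, ← hab]; exact hfφ.leadingCoeff
    have hua : IsUnit a.leadingCoeff := isUnit_iff_exists_inv.mpr ⟨_, hlead⟩
    have hub : IsUnit b.leadingCoeff :=
      isUnit_iff_exists_inv.mpr ⟨_, by rwa [mul_comm] at hlead⟩
    -- a unit-leading-coefficient factor that becomes a unit over `K` is a unit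
    have key : ∀ c : R[X], IsUnit c.leadingCoeff → IsUnit (c.map ψ) → IsUnit c := by
      intro c hc hcu
      have hne : ψ c.leadingCoeff ≠ 0 := (hc.map ψ).ne_zero
      have h0 : (c.map ψ).natDegree = 0 := natDegree_eq_zero_of_isUnit hcu
      rw [natDegree_map_of_leadingCoeff_ne_zero ψ hne] at h0
      rw [eq_C_of_natDegree_eq_zero h0]
      refine isUnit_C.mpr ?_
      have : c.leadingCoeff = c.coeff 0 := by rw [leadingCoeff, h0]
      rwa [this] at hc
    rcases hirr.isUnit_or_isUnit hKab with ha | hb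
    · exact Or.inl (key a hua ha)
    · exact Or.inr (key b hub hb)

/-- Over the rational function field `K(t_i)_{i ∈ ι} = Frac K[t_i]` a cyclotomic polynomial that
is irreducible over `K` stays irreducible: irreducible over `K[t_i]` by the retraction `t_i ↦ 0`
(`MvPolynomial.constantCoeff`, `irreducible_map_of_retraction`), then over the fraction field by
Gauss's lemma for the UFD `K[t_i]` (Mathlib `MvPolynomial.uniqueFactorizationMonoid`,
`UniqueFactorizationMonoid.instIsIntegrallyClosed`).  The step of [AbsTopI] Example 4.8 (i) p. 58 it
serves ("the prime `p` clearly serves as a prime “`l`”", for fields of positive transcendence degree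
over `Frac W(𝔽̄_p)`): `exists_not_isPrimitiveRoot_of_fg_fracWitt`. [cite: MochizukiAbsTopI2012, Ex 4.8 (i) p.58] -/
theorem cyclotomic_irreducible_fractionRing_mvPolynomial {K : Type*} [Field K] (ι : Type*) {m : ℕ}
    (h : Irreducible (cyclotomic m K)) :
    Irreducible (cyclotomic m (FractionRing (MvPolynomial ι K))) := by
  have hR : Irreducible (cyclotomic m (MvPolynomial ι K)) := by
    rw [← map_cyclotomic m (MvPolynomial.C : K →+* MvPolynomial ι K)]
    exact irreducible_map_of_retraction MvPolynomial.C MvPolynomial.constantCoeff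
      (fun x => MvPolynomial.constantCoeff_C _ x) (cyclotomic.monic m K) h
  rw [(cyclotomic.monic m _).irreducible_iff_irreducible_map_fraction_map
    (K := FractionRing (MvPolynomial ι K)), map_cyclotomic] at hR
  exact hR

/-- Irreducibility of a polynomial is invariant under a ring isomorphism of the coefficient rings
(`Polynomial.mapEquiv`). [folklore] -/
private theorem irreducible_map_ringEquiv_iff {R S : Type*} [CommRing R] [CommRing S] (e : R ≃+* S)
    (f : R[X]) : Irreducible (f.map (e : R →+* S)) ↔ Irreducible f :=
  MulEquiv.irreducible_iff (Polynomial.mapEquiv e).toMulEquiv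

/-- **Core lemma.** A finitely generated field extension `L` of `F = Frac W(𝔽̄_p)` ([Tpcs] Def 4.11
p. 44: the fields whose subfields are the generalized sub-`p`-adic fields) contains primitive
`p^{n+1}`-th roots of unity for only finitely many `n` — none for `n ≥ [L : F(t)]`, `t` a
transcendence basis of `L/F`: `Φ_{p^{n+1}}` is irreducible over `F(t) ≅ Frac F[t]`
(`cyclotomic_prime_pow_irreducible_fracWitt`, `cyclotomic_irreducible_fractionRing_mvPolynomial`,
Mathlib `AlgebraicIndependent.aevalEquivField`), so it is the minimal polynomial over `F(t)` of any
primitive `p^{n+1}`-th root of unity `ζ ∈ L`, whence `p^n (p - 1) = [F(t)(ζ) : F(t)] ≤ [L : F(t)]`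
(`minpoly.natDegree_le`); but `p^n (p-1) ≥ 2^n > n`.  This is the field-theoretic content of "the
prime `p` clearly serves as a prime `l`" in [AbsTopI] Example 4.8 (i) p. 58.
[cite: MochizukiAbsTopI2012, Ex 4.8 (i) p.58] -/
theorem exists_not_isPrimitiveRoot_of_fg_fracWitt (p : ℕ) [hp : Fact p.Prime] (L : Type*) [Field L]
    [Algebra (FractionRing (WittVector p (AlgebraicClosure (ZMod p)))) L]
    (hfg : (⊤ : IntermediateField (FractionRing (WittVector p (AlgebraicClosure (ZMod p)))) L).FG) :
    ∃ N : ℕ, ∀ ζ : L, ¬ IsPrimitiveRoot ζ (p ^ (N + 1)) := by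
  set F : Type := FractionRing (WittVector p (AlgebraicClosure (ZMod p))) with hF
  haveI : Algebra.EssFiniteType F L := IntermediateField.fg_top_iff.mp hfg
  -- a transcendence basis inside a finite generating set (as in `GaussOrderDVR`)
  obtain ⟨s, hs⟩ := hfg
  have halg : Algebra.IsAlgebraic (Algebra.adjoin F (s : Set L)) L := by
    rw [← IntermediateField.isAlgebraic_adjoin_iff_top, hs, Algebra.isAlgebraic_iff_isIntegral]
    exact Algebra.isIntegral_of_surjective IntermediateField.topEquiv.surjective
  obtain ⟨t, -, ht⟩ := exists_isTranscendenceBasis_subset (R := F) (s : Set L)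
  set F' : IntermediateField F L :=
    IntermediateField.adjoin F (Set.range ((↑) : t → L)) with hF'
  haveI : Algebra.EssFiniteType F' L := Algebra.EssFiniteType.of_comp F F' L
  haveI : Algebra.IsAlgebraic F' L := ht.isAlgebraic_field
  haveI : Module.Finite F' L := Algebra.finite_of_essFiniteType_of_isAlgebraic
  -- `Φ_{p^{n+1}}` is irreducible over `F' ≅ F(t)`
  have hirr : ∀ n : ℕ, Irreducible (cyclotomic (p ^ (n + 1)) F') := by
    intro n
    have h1 := cyclotomic_irreducible_fractionRing_mvPolynomial t
      (cyclotomic_prime_pow_irreducible_fracWitt p n)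
    set e : FractionRing (MvPolynomial t F) ≃ₐ[F] F' := ht.1.aevalEquivField with he
    rw [← irreducible_map_ringEquiv_iff (e : FractionRing (MvPolynomial t F) ≃+* F'),
      map_cyclotomic] at h1
    exact h1
  -- hence a primitive `p^{n+1}`-th root of unity in `L` forces `φ(p^{n+1}) ≤ [L : F']`
  refine ⟨Module.finrank F' L, fun ζ hζ => ?_⟩
  set N := Module.finrank F' L with hN
  haveI : CharZero L := by
    obtain ⟨φ₀⟩ := AbsTopIII.nonempty_padic_ringHom_fracWitt p
    haveI : CharZero F := charZero_of_injective_ringHom φ₀.injective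
    exact charZero_of_injective_ringHom (algebraMap F L).injective
  haveI : NeZero ((p ^ (N + 1) : ℕ) : L) := NeZero.charZero
  have hroot : Polynomial.aeval ζ (cyclotomic (p ^ (N + 1)) F') = 0 := by
    rw [Polynomial.aeval_def, ← Polynomial.eval_map, map_cyclotomic, ← Polynomial.IsRoot.def]
    exact hζ.isRoot_cyclotomic (pow_pos hp.out.pos _)
  have hmin : minpoly F' ζ = cyclotomic (p ^ (N + 1)) F' :=
    (minpoly.eq_of_irreducible_of_monic (hirr N) hroot (cyclotomic.monic _ _)).symm
  have hle : (minpoly F' ζ).natDegree ≤ N := minpoly.natDegree_le ζ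
  rw [hmin, natDegree_cyclotomic, Nat.totient_prime_pow hp.out (Nat.succ_pos N),
    Nat.succ_sub_one] at hle
  -- `p^N (p-1) ≤ N` is absurd
  have h1 : N < 2 ^ N := Nat.lt_two_pow_self
  have h2 : 2 ^ N ≤ p ^ N := Nat.pow_le_pow_left hp.out.two_le N
  have h3 : p ^ N ≤ p ^ N * (p - 1) :=
    Nat.le_mul_of_pos_right _ (Nat.sub_pos_of_lt hp.out.one_lt)
  exact absurd (h1.trans_le (h2.trans (h3.trans hle))) (lt_irrefl N)

/-! ### The cyclotomic character of a generalized sub-`p`-adic field -/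

open Field Literature.NumberTheory.GaloisRepresentations in
/-- **For a generalized sub-`p`-adic field `k`, the `p`-adic cyclotomic character
`χ_p : G_k → ℤ_p^×` has open image** ([AbsTopI] Ex 4.8 (i) p. 58: "the prime `p` clearly serves
as a prime “`l`” as in the statement of Theorem 4.7", i.e. Thm 4.7 (b) p. 56 / the hypothesis of
Lemma 4.5 p. 54 "the cyclotomic character `χ_G^cyclo : G → ℤ_l^×` [...] has open image", for `l = p`
and `G = G_k`, `k` generalized sub-`p`-adic; likewise the standing hypothesis of [AbsTopII] Cor 3.7 in
the generality of Rmk 3.7.1).  Proof: the image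
is compact, hence closed, hence finite or open; if finite, the fixed field `L` of `ker χ_p` is a finite
extension of `k` containing `μ_{p^∞}(k̄)`, again generalized sub-`p`-adic, so it embeds into a
finitely generated extension of `Frac W(𝔽̄_p)` containing primitive `p^{n}`-th roots of unity for all
`n` — contradicting `exists_not_isPrimitiveRoot_of_fg_fracWitt`.  Supplies the hypothesis `hcyc` of
`AbsTopI.ConstructionDataClass.ex_4_8_i_of` (`AbsTopI/RelativeGC.lean`) and the field
`cyclotomicallyFull` of `AbsTopII.BelyiCurveModel.IsCor37Input` for curves over generalized
sub-`p`-adic fields ([AbsTopII] Rmk 3.7.1). [cite: MochizukiAbsTopI2012, Ex 4.8 (i) p.58] -/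
theorem IsGeneralizedSubpadicFor.isOpen_range_cyclotomicChar {k : Type u} [Field k] {p : ℕ}
    [hp : Fact p.Prime] (hk : IsGeneralizedSubpadicFor k p) :
    IsOpen (Set.range (cyclotomicChar k p)) := by
  classical
  haveI : CharZero k := hk.charZero
  haveI : NeZero p := ⟨hp.out.ne_zero⟩
  by_contra hno
  set χ := GaloisRep.cyclotomicCharacter k p with hχdef
  have hχ : ∀ σ, cyclotomicChar k p σ = χ σ := fun σ => rfl
  have hrange : Set.range (cyclotomicChar k p) = (χ.toMonoidHom.range : Set ℤ_[p]ˣ) := by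
    rw [MonoidHom.coe_range]
    ext x
    simp only [Set.mem_range, hχ]
    rfl
  have hclosed : IsClosed (χ.toMonoidHom.range : Set ℤ_[p]ˣ) := by
    rw [MonoidHom.coe_range]
    exact (isCompact_range χ.continuous).isClosed
  rcases PadicInt.finite_or_isOpen_of_isClosed_subgroup_units _ hclosed with hfin | hopen
  swap
  · exact hno (hrange ▸ hopen)
  rw [MonoidHom.coe_range] at hfin
  -- the kernel of `χ`: a closed subgroup of finite index, and its fixed field `L`
  set H : Subgroup (absoluteGaloisGroup k) := χ.toMonoidHom.ker with hH
  have hHclosed : IsClosed (H : Set (absoluteGaloisGroup k)) := by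
    have : IsClosed ({1} : Set ℤ_[p]ˣ) := isClosed_singleton
    exact this.preimage χ.continuous
  set H' : Subgroup (AlgebraicClosure k ≃ₐ[k] AlgebraicClosure k) :=
    H.map (absoluteGaloisGroup.toAlgEquiv k).toMonoidHom with hH'
  have hH'closed : IsClosed (H' : Set (AlgebraicClosure k ≃ₐ[k] AlgebraicClosure k)) := by
    have hHeq : (H' : Set (AlgebraicClosure k ≃ₐ[k] AlgebraicClosure k)) =
        (absoluteGaloisGroup.toAlgEquiv k).symm ⁻¹' H := by
      rw [hH', Subgroup.coe_map]
      exact (absoluteGaloisGroup.toAlgEquiv k).toEquiv.image_eq_preimage_symm _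
    rw [hHeq]
    exact hHclosed.preimage continuous_id
  set L := IntermediateField.fixedField H' with hL
  have hfix : L.fixingSubgroup = H' := InfiniteGalois.fixingSubgroup_fixedField ⟨H', hH'closed⟩
  have hcard : Nat.card χ.toMonoidHom.range = Nat.card (Set.range χ) := rfl
  have hindex : Module.finrank k L = Nat.card (Set.range χ) := by
    rw [IntermediateField.finrank_eq_fixingSubgroup_index, hfix, hH',
      Subgroup.index_map_of_bijective (absoluteGaloisGroup.toAlgEquiv k).bijective, hH,
      Subgroup.index_ker, hcard]
  haveI : Finite (Set.range χ) := hfin.to_subtype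
  haveI : Nonempty (Set.range χ) := ⟨⟨χ 1, 1, rfl⟩⟩
  have hpos : 0 < Module.finrank k L := by rw [hindex]; exact Nat.card_pos
  haveI : FiniteDimensional k L := Module.finite_of_finrank_pos hpos
  -- every `p`-power root of unity of `k̄` lies in `L`
  have hmemL : ∀ (n : ℕ) (t : AlgebraicClosure k), t ^ p ^ (n + 1) = 1 → t ∈ L := by
    intro n t ht
    rw [hL, IntermediateField.mem_fixedField_iff]
    rintro f ⟨σ, hσ, rfl⟩
    rw [SetLike.mem_coe, hH, MonoidHom.mem_ker] at hσ
    change (absoluteGaloisGroup.toAlgEquiv k σ) t = t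
    haveI : NeZero (p : k) := NeZero.charZero
    haveI : Fact (1 < p ^ (n + 1)) := ⟨Nat.one_lt_pow (Nat.succ_ne_zero n) hp.out.one_lt⟩
    rw [← absoluteGaloisGroup.smul_def, GaloisRep.cyclotomicCharacter_spec k p σ t ht,
      show GaloisRep.cyclotomicCharacter k p σ = 1 from hσ, Units.val_one, map_one, ZMod.val_one,
      pow_one]
  -- `L` is a finite extension of `k`, hence generalized sub-`p`-adic: it embeds into a finitely
  -- generated extension `L'` of `Frac W(𝔽̄_p)`, which has no primitive `p^{N+1}`-th root of unity
  have hLgen : IsGeneralizedSubpadicFor (L : Type u) p := hk.of_finite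
  obtain ⟨L', _, _, hfg, ⟨ι⟩⟩ := hLgen.exists_embedding
  obtain ⟨N, hN⟩ := exists_not_isPrimitiveRoot_of_fg_fracWitt p L' hfg
  -- but `k̄` has a primitive `p^{N+1}`-th root of unity, which lies in `L`
  haveI : NeZero (((p ^ (N + 1) : ℕ) : AlgebraicClosure k)) := NeZero.charZero
  obtain ⟨ζ, hζ⟩ := HasEnoughRootsOfUnity.exists_primitiveRoot (AlgebraicClosure k) (p ^ (N + 1))
  have hζL : ζ ∈ L := hmemL N ζ hζ.pow_eq_one
  have hζ' : IsPrimitiveRoot (⟨ζ, hζL⟩ : L) (p ^ (N + 1)) :=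
    IsPrimitiveRoot.coe_submonoidClass_iff.mp hζ
  exact hN (ι ⟨ζ, hζL⟩) (hζ'.map_of_injective ι.injective)

end Literature.AnabelianGeometry.AbsoluteAnabelian.AbsTopIII
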